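import Literature.AlgebraicGeometry.AbelianSchemes.SerreTensorPoints
import HarnessLib

/-!
# The `𝒪`-module `Hom_𝒪(X, A)` of equivariant homomorphisms and `Hom_𝒪(X, A ⊗_𝒪 𝔟) ≅ Hom_𝒪(X, A) ⊗_𝒪 𝔟`

Topic `AlgebraicGeometry/AbelianSchemes`, namespace `Literature.AlgebraicGeometry.AbelianSchemes.AbelianSchemeOver` (constructions with bodies +
proved theorems; no named fact, no `sorry`, no `instance`, no notation; ANY base scheme `S`, any commutative `𝒪`).  Cell `hodgecm-mathlib`, F0/P6
«MOD», organ **ST-4 (core, covariant half)** of desk F0P6a-plan (g0) (ED3-CENSUS-P6a v1 §3∕§6 «`Hom_{𝒪_F}(A₀ ⊗ 𝔟₀, A ⊗ 𝔟) ≅ Hom_{𝒪_F}(A₀, A) ⊗ 𝔟₀⁻¹𝔟`»: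
this file is the factor `⊗ 𝔟` in the TARGET; the source factor `𝔟₀⁻¹ = 𝔟₀^∨` and the hermitian ∕ level clauses are separate files) over ★ FILE 10
`SerreTensorPoints` (p845057) and ★ `Algebra/Module/IdempotentMatrixFixedTensor` (p844853); `--supports stmt-HodgeConjecture-24832`, count-neutral.
HC_CM is proved only modulo the 2 remaining named inputs (hLiu418, h413) until rung 0 closes; this file discharges none of them.

## Mathematics

For abelian `S`-schemes `X`, `A` with ring actions `ι_X, ι : 𝒪 → End` (★ `RingAction`), the `𝒪`-EQUIVARIANT HOMOMORPHISMS `X → A` form an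
`𝒪`-submodule `Hom_𝒪(X, A)` of the `𝒪`-module `A(X)` of `X`-valued points (★ `RingAction.Pts`; `a • f = f ≫ ι(a)`): closed under the group law
because `A` is commutative, under `a •` because `𝒪` is commutative (§1).  For the Serre tensor `A ⊗_𝒪 𝔟 = Fix([E] ↷ Aⁿ)` (`𝔟 = E·𝒪ⁿ`), a point
`t : X → A ⊗_𝒪 𝔟` is a homomorphism iff its coordinates `t_k = t ≫ ι ≫ pr_k : X → A` are, and is equivariant iff its coordinates are (the Serre
action is coordinatewise, ★ `serreAction_i_comp_ι`, ★ `matrixEnd_scalar_powProj`) (§2).  Hence the points isomorphism `(A ⊗_𝒪 𝔟)(X) ≅ {v ∈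
A(X)ⁿ : E·v = v}` (★ `serrePtsEquiv`) restricts to

  **`Hom_𝒪(X, A ⊗_𝒪 𝔟) ≃ₗ[𝒪] {v ∈ Hom_𝒪(X, A)ⁿ : E·v = v} ≃ₗ[𝒪] Hom_𝒪(X, A) ⊗_𝒪 𝔟`**

(§3; the second step is ★ `tensorRangeEquivFixed` for the module `Hom_𝒪(X, A)`), i.e. `Hom_𝒪(X, −)` commutes with Serre tensors (B. Conrad,
*Gross–Zagier revisited* §7: `M ⊗_A 𝔐` represents `T ↦ M ⊗_A 𝔐(T)`; [RapoportSmithlingZhang2020Diagonal] §3.2: the hermitian module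
`Hom_{𝒪_F}(A₀, A)` of the moduli problem).

## Contents

* §1 **`RingAction.homSubmodule actX actY : Submodule O (actY.Pts X.X)`**, `mem_homSubmodule_iff`, `isMonHom_of_mem_homSubmodule`,
  `comp_eq_of_mem_homSubmodule`, `mk_mem_homSubmodule`.
* §2 `isMonHom_coord`, `isMonHom_of_coords`, `comp_coord_eq_of_equivariant`, `equivariant_of_coords` (homomorphism ∕ equivariance of a point of
  `A ⊗_𝒪 𝔟` is read on coordinates).
* §3 `coe_smulVecLin_subtype` (plumbing), **`serreHomFixedEquiv`** (`Hom_𝒪(X, A ⊗ 𝔟) ≃ₗ[O] fixedSubmodule (Hom_𝒪(X, A)) E`, + `_coe`),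
  **`serreHomTensorEquiv`** (`≃ₗ[O] Hom_𝒪(X, A) ⊗[O] range E`), `serreHomTensorEquiv_symm_tmul_coe` (pure tensors `f ⊗ v ↦` the homomorphism with
  coordinates `(v_k • f)_k`).

## References
* [Conrad2004GrossZagier] B. Conrad, *Gross–Zagier revisited*, MSRI Publ. 49 (2004), §7 (Thm. 7.5) (functor of points of `M ⊗_A 𝔐`).
* [RapoportSmithlingZhang2020Diagonal] M. Rapoport, B. Smithling, W. Zhang, *Arithmetic diagonal cycles on unitary Shimura varieties* (2020), §3.2
  (the hermitian `𝒪_F`-module `Hom_{𝒪_F}(A₀, A)`).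
* [Kottwitz1992] R. Kottwitz, *Points on some Shimura varieties over finite fields*, JAMS 5 (1992), §5 (p. 390).
* Tree: ★ `AbelianSchemes/SerreTensorPoints`, ★ `Algebra/Module/IdempotentMatrixFixedTensor`.
-/

noncomputable section

universe u

open CategoryTheory CategoryTheory.Limits AlgebraicGeometry MonoidalCategory CartesianMonoidalCategory
open scoped MonObj TensorProduct

namespace Literature.AlgebraicGeometry.AbelianSchemes

namespace AbelianSchemeOver

open Literature.Algebra.Module.IdempotentMatrix RingAction

variable {S : Scheme.{u}} {X A : AbelianSchemeOver S} {O : Type*} [CommRing O] (actX : X.RingAction O) (act : A.RingAction O)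
  [IsCommMonObj A.X]

/-! ## §1 The `𝒪`-module `Hom_𝒪(X, A)` of equivariant homomorphisms -/

namespace RingAction

/-- **`Hom_𝒪(X, A)`**: the `𝒪`-submodule of `A(X)` (★ `Pts`, `a • f = f ≫ ι(a)`) of the `𝒪`-EQUIVARIANT HOMOMORPHISMS `X → A`
(`A` commutative, `𝒪` commutative). [cite: RapoportSmithlingZhang2020Diagonal, §3.2] [cite: Conrad2004GrossZagier, §7] -/
def homSubmodule : Submodule O (act.Pts X.X) where
  carrier := {x | IsMonHom (Pts.hom act X.X x) ∧ ∀ a, actX.i a ≫ Pts.hom act X.X x = Pts.hom act X.X x ≫ act.i a}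
  zero_mem' := by
    refine ⟨?_, fun a => ?_⟩
    · rw [Pts.hom_zero, Hom.one_def]
      infer_instance
    · haveI := act.isMonHom a
      rw [Pts.hom_zero, MonObj.comp_one, MonObj.one_comp]
  add_mem' {x y} hx hy := by
    refine ⟨?_, fun a => ?_⟩
    · haveI := hx.1
      haveI := hy.1
      rw [Pts.hom_add, Hom.mul_def]
      infer_instance
    · haveI := act.isMonHom a
      rw [Pts.hom_add, MonObj.comp_mul, hx.2 a, hy.2 a, MonObj.mul_comp]
  smul_mem' c x hx := by
    refine ⟨?_, fun a => ?_⟩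
    · haveI := hx.1
      haveI := act.isMonHom c
      rw [Pts.hom_smul]
      infer_instance
    · rw [Pts.hom_smul, ← Category.assoc, hx.2 a, Category.assoc, Category.assoc, act.i_comm]

/-- Membership in `Hom_𝒪(X, A)`: homomorphism ∧ equivariant. [cite: RapoportSmithlingZhang2020Diagonal, §3.2] -/
theorem mem_homSubmodule_iff (x : act.Pts X.X) :
    x ∈ homSubmodule actX act ↔ IsMonHom (Pts.hom act X.X x) ∧ ∀ a, actX.i a ≫ Pts.hom act X.X x = Pts.hom act X.X x ≫ act.i a :=
  Iff.rfl

/-- An element of `Hom_𝒪(X, A)` is a homomorphism. [cite: RapoportSmithlingZhang2020Diagonal, §3.2] -/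
theorem isMonHom_of_mem_homSubmodule {x : act.Pts X.X} (hx : x ∈ homSubmodule actX act) : IsMonHom (Pts.hom act X.X x) := hx.1

/-- An element of `Hom_𝒪(X, A)` is equivariant. [cite: RapoportSmithlingZhang2020Diagonal, §3.2] -/
theorem comp_eq_of_mem_homSubmodule {x : act.Pts X.X} (hx : x ∈ homSubmodule actX act) (a : O) :
    actX.i a ≫ Pts.hom act X.X x = Pts.hom act X.X x ≫ act.i a :=
  hx.2 a

/-- An equivariant homomorphism `f : X → A` defines an element `mk f ∈ Hom_𝒪(X, A)`. [cite: RapoportSmithlingZhang2020Diagonal, §3.2] -/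
theorem mk_mem_homSubmodule (f : X.X ⟶ A.X) [IsMonHom f] (hf : ∀ a, actX.i a ≫ f = f ≫ act.i a) :
    Pts.mk act X.X f ∈ homSubmodule actX act :=
  ⟨by rw [Pts.hom_mk]; infer_instance, fun a => by rw [Pts.hom_mk]; exact hf a⟩

end RingAction

/-! ## §2 Homomorphism ∕ equivariance of a point of `A ⊗_𝒪 𝔟` is read on its coordinates -/

section Coords

variable {n : ℕ} (E : Matrix (Fin n) (Fin n) O) (hE : E * E = E)

/-- The coordinates `t ≫ ι ≫ pr_k` of a homomorphism `t : X → A ⊗_𝒪 𝔟` are homomorphisms. [cite: Kottwitz1992, §5 (p. 390)] -/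
theorem isMonHom_coord (t : X.X ⟶ (serreTensor act E hE).X) [IsMonHom t] (k : Fin n) :
    IsMonHom ((serreHomEquiv act E hE X.X t : Fin n → (X.X ⟶ A.X)) k) := by
  haveI := (isMonHom_serreι_serreπ act E hE).1
  haveI := A.isMonHom_powProj n k
  rw [serreHomEquiv_apply_coe]
  infer_instance

/-- Conversely a point of `A ⊗_𝒪 𝔟` all of whose coordinates are homomorphisms is a homomorphism (`t = (t_k)_k ≫ π`).
[cite: Kottwitz1992, §5 (p. 390)] -/
theorem isMonHom_of_coords (t : X.X ⟶ (serreTensor act E hE).X)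
    (ht : ∀ k, IsMonHom ((serreHomEquiv act E hE X.X t : Fin n → (X.X ⟶ A.X)) k)) : IsMonHom t := by
  haveI := (isMonHom_serreι_serreπ act E hE).2.1
  haveI := isMonHom_powLift (fun k => (serreHomEquiv act E hE X.X t : Fin n → (X.X ⟶ A.X)) k) ht
  rw [← (serreHomEquiv act E hE X.X).symm_apply_apply t, serreHomEquiv_symm_apply]
  infer_instance

/-- The coordinates of an EQUIVARIANT point are equivariant: `ι_X(a) ≫ t_k = t_k ≫ ι(a)`. [cite: Kottwitz1992, §5 (p. 390)] -/
theorem comp_coord_eq_of_equivariant (t : X.X ⟶ (serreTensor act E hE).X) (ht : ∀ a, actX.i a ≫ t = t ≫ (serreAction act E hE).i a)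
    (a : O) (k : Fin n) :
    actX.i a ≫ (serreHomEquiv act E hE X.X t : Fin n → (X.X ⟶ A.X)) k =
      (serreHomEquiv act E hE X.X t : Fin n → (X.X ⟶ A.X)) k ≫ act.i a := by
  simp only [serreHomEquiv_apply_coe, Category.assoc]
  rw [← Category.assoc (actX.i a), ht a, Category.assoc, serreAction_i_comp_ι_assoc, matrixEnd_scalar_powProj]

/-- Conversely a point with equivariant coordinates is equivariant. [cite: Kottwitz1992, §5 (p. 390)] -/
theorem equivariant_of_coords (t : X.X ⟶ (serreTensor act E hE).X)
    (ht : ∀ a k, actX.i a ≫ (serreHomEquiv act E hE X.X t : Fin n → (X.X ⟶ A.X)) k =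
      (serreHomEquiv act E hE X.X t : Fin n → (X.X ⟶ A.X)) k ≫ act.i a) (a : O) :
    actX.i a ≫ t = t ≫ (serreAction act E hE).i a := by
  haveI := (isMonHom_serreι_serreπ act E hE).2.2
  rw [← cancel_mono (serreι act E hE), Category.assoc, Category.assoc, serreAction_i_comp_ι]
  refine pow_hom_ext fun k => ?_
  have h := ht a k
  simp only [serreHomEquiv_apply_coe, Category.assoc] at h
  simp only [Category.assoc]
  rw [h, matrixEnd_scalar_powProj]

end Coords

/-! ## §3 `Hom_𝒪(X, A ⊗_𝒪 𝔟) ≃ₗ[𝒪] Fix_E(Hom_𝒪(X, A)ⁿ) ≃ₗ[𝒪] Hom_𝒪(X, A) ⊗_𝒪 𝔟` -/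

section HomTensor

variable {n : ℕ} (E : Matrix (Fin n) (Fin n) O) (hE : E * E = E)

/-- Plumbing: `E·v` computed in a submodule `N` agrees with `E·v` computed in the ambient module. [cite: Conrad2004GrossZagier, §7] -/
theorem coe_smulVecLin_subtype {M : Type*} [AddCommGroup M] [Module O M] (N : Submodule O M) (v : Fin n → N) (j : Fin n) :
    ((smulVecLin N E v j : N) : M) = smulVecLin M E (fun k => (v k : M)) j := by
  simp only [smulVecLin_apply, Submodule.coe_sum, Submodule.coe_smul]

variable [IsCommMonObj (serreTensor act E hE).X]

/-- An element of `Hom_𝒪(X, A ⊗ 𝔟)` has coordinates in `Hom_𝒪(X, A)`. [cite: Conrad2004GrossZagier, §7 (Thm. 7.5)] -/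
theorem serrePtsEquiv_coe_mem_homSubmodule {x : (serreAction act E hE).Pts X.X}
    (hx : x ∈ homSubmodule actX (serreAction act E hE)) (k : Fin n) :
    (serrePtsEquiv act E hE X.X x : Fin n → act.Pts X.X) k ∈ homSubmodule actX act := by
  haveI := hx.1
  refine ⟨?_, fun a => ?_⟩
  · have h := isMonHom_coord act E hE (Pts.hom _ X.X x) k
    rw [serreHomEquiv_apply_coe, Category.assoc] at h
    rw [hom_serrePtsEquiv_coe]
    exact h
  · have h := comp_coord_eq_of_equivariant actX act E hE (Pts.hom _ X.X x) hx.2 a k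
    rw [serreHomEquiv_apply_coe, Category.assoc] at h
    rw [hom_serrePtsEquiv_coe]
    exact h

/-- Conversely a fixed vector of elements of `Hom_𝒪(X, A)` comes from an element of `Hom_𝒪(X, A ⊗ 𝔟)`. [cite: Conrad2004GrossZagier, §7 (Thm. 7.5)] -/
theorem serrePtsEquiv_symm_mem_homSubmodule (v : fixedSubmodule (act.Pts X.X) E)
    (hv : ∀ k, (v : Fin n → act.Pts X.X) k ∈ homSubmodule actX act) :
    (serrePtsEquiv act E hE X.X).symm v ∈ homSubmodule actX (serreAction act E hE) := by
  have hc : ∀ k, (serreHomEquiv act E hE X.X (Pts.hom _ X.X ((serrePtsEquiv act E hE X.X).symm v)) : Fin n → (X.X ⟶ A.X)) k =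
      Pts.hom act X.X ((v : Fin n → act.Pts X.X) k) := fun k => by
    rw [serreHomEquiv_apply_coe, Category.assoc, ← hom_serrePtsEquiv_coe, LinearEquiv.apply_symm_apply]
  refine ⟨isMonHom_of_coords act E hE _ fun k => ?_, equivariant_of_coords actX act E hE _ fun a k => ?_⟩
  · rw [hc k]; exact (hv k).1
  · rw [hc k]; exact (hv k).2 a

/-- **`Hom_𝒪(X, A ⊗_𝒪 𝔟) ≃ₗ[𝒪] Fix_E(Hom_𝒪(X, A)ⁿ)`**: the points isomorphism ★ `serrePtsEquiv` restricted to equivariant homomorphisms.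
[cite: Conrad2004GrossZagier, §7 (Thm. 7.5)] [cite: RapoportSmithlingZhang2020Diagonal, §3.2] -/
def serreHomFixedEquiv :
    homSubmodule actX (serreAction act E hE) ≃ₗ[O] fixedSubmodule (homSubmodule actX act) E where
  toFun x := ⟨fun k => ⟨(serrePtsEquiv act E hE X.X x.1 : Fin n → act.Pts X.X) k, serrePtsEquiv_coe_mem_homSubmodule actX act E hE x.2 k⟩, by
    rw [mem_fixedSubmodule_iff]
    funext j
    apply Subtype.ext
    rw [coe_smulVecLin_subtype]
    exact congrFun ((mem_fixedSubmodule_iff _ E _).1 (serrePtsEquiv act E hE X.X x.1).2) j⟩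
  invFun v := ⟨(serrePtsEquiv act E hE X.X).symm ⟨fun k => ((v : Fin n → homSubmodule actX act) k : act.Pts X.X), by
      rw [mem_fixedSubmodule_iff]
      funext j
      have h := congrFun ((mem_fixedSubmodule_iff _ E _).1 v.2) j
      rw [← coe_smulVecLin_subtype, h]⟩,
    serrePtsEquiv_symm_mem_homSubmodule actX act E hE _ fun k => ((v : Fin n → homSubmodule actX act) k).2⟩
  map_add' x y := by
    apply Subtype.ext; funext k; apply Subtype.ext
    change (serrePtsEquiv act E hE X.X (x.1 + y.1) : Fin n → act.Pts X.X) k = _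
    rw [map_add]
    rfl
  map_smul' c x := by
    apply Subtype.ext; funext k; apply Subtype.ext
    change (serrePtsEquiv act E hE X.X (c • x.1) : Fin n → act.Pts X.X) k = _
    rw [map_smul]
    rfl
  left_inv x := by
    apply Subtype.ext
    change (serrePtsEquiv act E hE X.X).symm _ = x.1
    rw [LinearEquiv.symm_apply_eq]
  right_inv v := by
    apply Subtype.ext; funext k; apply Subtype.ext
    change (serrePtsEquiv act E hE X.X ((serrePtsEquiv act E hE X.X).symm _) : Fin n → act.Pts X.X) k = _
    rw [LinearEquiv.apply_symm_apply]

/-- Coordinates of `serreHomFixedEquiv x`: the underlying points are those of ★ `serrePtsEquiv`. [cite: Conrad2004GrossZagier, §7 (Thm. 7.5)] -/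
theorem serreHomFixedEquiv_coe (x : homSubmodule actX (serreAction act E hE)) (k : Fin n) :
    (((serreHomFixedEquiv actX act E hE x : Fin n → homSubmodule actX act) k : act.Pts X.X)) =
      (serrePtsEquiv act E hE X.X x.1 : Fin n → act.Pts X.X) k := rfl

/-- **`Hom_𝒪(X, A ⊗_𝒪 𝔟) ≃ₗ[𝒪] Hom_𝒪(X, A) ⊗_𝒪 𝔟`** for `𝔟 = E·𝒪ⁿ = range E`: `Hom_𝒪(X, −)` commutes with Serre tensors.
[cite: Conrad2004GrossZagier, §7 (Thm. 7.5)] [cite: RapoportSmithlingZhang2020Diagonal, §3.2] -/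
def serreHomTensorEquiv :
    homSubmodule actX (serreAction act E hE) ≃ₗ[O] homSubmodule actX act ⊗[O] LinearMap.range (Matrix.toLin' E) :=
  (serreHomFixedEquiv actX act E hE).trans (tensorRangeEquivFixed (homSubmodule actX act) E hE).symm

/-- On pure tensors the inverse sends `f ⊗ v` (`f ∈ Hom_𝒪(X, A)`, `v ∈ E·𝒪ⁿ`) to the equivariant homomorphism `X → A ⊗ 𝔟` with coordinates
`(v_k • f)_k = (f ≫ ι(v_k))_k`. [cite: Conrad2004GrossZagier, §7 (Thm. 7.5)] -/
theorem serreHomTensorEquiv_symm_tmul_coe (f : homSubmodule actX act) (v : LinearMap.range (Matrix.toLin' E)) (k : Fin n) :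
    (((serreHomFixedEquiv actX act E hE ((serreHomTensorEquiv actX act E hE).symm (f ⊗ₜ v)) : Fin n → homSubmodule actX act) k :
      act.Pts X.X)) = (v : Fin n → O) k • (f : act.Pts X.X) := by
  change (((serreHomFixedEquiv actX act E hE ((serreHomFixedEquiv actX act E hE).symm
    (tensorRangeEquivFixed (homSubmodule actX act) E hE (f ⊗ₜ v))) : Fin n → homSubmodule actX act) k : act.Pts X.X)) = _
  rw [LinearEquiv.apply_symm_apply, tensorRangeEquivFixed_tmul_coe, Submodule.coe_smul]

end HomTensor

end AbelianSchemeOver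

end Literature.AlgebraicGeometry.AbelianSchemes

end
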